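import Summits.ValiantsHypothesis.ValiantsHypothesis.Theorems.KPlusLogSqLawTropicalSymmetricOrbitThreeFourSixteenOrient
import Summits.ValiantsHypothesis.ValiantsHypothesis.Theorems.KPlusLogSqLawTropicalOrbitTripleRule
import Summits.ValiantsHypothesis.ValiantsHypothesis.Theorems.KPlusLogSqLawTropicalOrbitChainParity
import Summits.ValiantsHypothesis.ValiantsHypothesis.Theorems.KPlusLogSqLawTropicalSymmetricOrbitThreeFourFloor
import Summits.ValiantsHypothesis.ValiantsHypothesis.Theorems.KPlusLogSqLawTropicalSymmetricOrbitThreeFourSixteenM013003P3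
import Summits.ValiantsHypothesis.ValiantsHypothesis.Theorems.KPlusLogSqLawTropicalSymmetricOrbitThreeFourSixteenM013023P9
import Summits.ValiantsHypothesis.ValiantsHypothesis.Theorems.KPlusLogSqLawTropicalSymmetricOrbitThreeFourSixteenM023033P3
import Summits.ValiantsHypothesis.ValiantsHypothesis.Theorems.KPlusLogSqLawTropicalSymmetricOrbitThreeFourSixteenM112013P5
import Summits.ValiantsHypothesis.ValiantsHypothesis.Theorems.KPlusLogSqLawTropicalSymmetricOrbitThreeFourSixteenM112023P8
import Summits.ValiantsHypothesis.ValiantsHypothesis.Theorems.KPlusLogSqLawTropicalSymmetricOrbitThreeFourSixteenM112113P3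
import Summits.ValiantsHypothesis.ValiantsHypothesis.Theorems.KPlusLogSqLawTropicalSymmetricOrbitThreeFourSixteenM112122P8
import Summits.ValiantsHypothesis.ValiantsHypothesis.Theorems.KPlusLogSqLawTropicalSymmetricOrbitThreeFourSixteenM112222P3
import Summits.ValiantsHypothesis.ValiantsHypothesis.Theorems.KPlusLogSqLawTropicalSymmetricOrbitThreeFourSixteenM122013P10
import Summits.ValiantsHypothesis.ValiantsHypothesis.Theorems.KPlusLogSqLawTropicalSymmetricOrbitThreeFourSixteenM122022P2
import Summits.ValiantsHypothesis.ValiantsHypothesis.Theorems.KPlusLogSqLawTropicalSymmetricOrbitThreeFourSixteenM122023P3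
import Summits.ValiantsHypothesis.ValiantsHypothesis.Theorems.KPlusLogSqLawTropicalSymmetricOrbitThreeFourSixteenM122111P3

/-!
# Route «KPlusLogSqLaw» — the symmetric `(3,4)` tropical row in the ORBIT model at the cell value: `T^orb_sym(3,4) ≤ 16` (`TSymOrb34Le16`)

HONEST FRAMING.  Helper file (seat val-sym-lift-p2 (g7), cell `pub-symmetroid`, 2026-08-27; `--supports` the `WeakLifting` item
stmt-ValiantsHypothesis-19561 as a helper, no closure claim).  SMALL-FORMAT kernel statement in the transpose-ORBIT carrier model of the
cell, far inside the known regime of the cruxes; docket of record «the 16» (R1797/R1798).  The row `≤ 17` is `core17` (p502374); its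
hypotheses (the PAIRWISE rules) admit an 18-element abstract chain (`core_hypotheses_admit_seventeen`, p505165).  Two further face-free
ingredients close the gap: the T-TRIPLE (three-term majorisation) rule `rule_T3` / `orbitChain_T3` (p509441) and the parity rules P1/P2 of an
alternating chain (`signChain_P1` / `signChain_P2`, p510197).  Under these, an abstract chain misses at least THREE of the twenty rank
multisets: the twelve missed pairs left open by the cores of `core17` (`orbY`, `orbV2`, `core5` and mirrors) are excluded by a GENERATED
finite case analysis (`miss_*`, seat tools `work/gen/search16.py` + `emit3.py`: a face-free search whose every leaf is an exact linear
certificate over the monotone exponents, closed by `omega`, or a rank comparison closed by `decide`; carriers normalised by `orient_elim`,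
root carriers up to `rotate_elim`).  Hence **`core16`**, **`tropRow_three_four_symmOrb_le_sixteen`**, **`tropRootLawAtSymmOrb_three_four_sixteen :
TropRootLawAtSymmOrb 3 4 16`** = **`tSymOrb34Le16_holds`**; with the floor p504693 (`¬ TropRootLawAtSymmOrb 3 4 15`) the orbit row of the cell is
EXACTLY 16 in the kernel.  Not sign-free (P1/P2 use the alternation).  Nothing here is about `TropicalB` / `WeakLifting` in their windows,
Conjecture B, DoorA34 = `PosRootLawAt 3 4 18` / DoorA26 (OPEN, typed, never asserted), `MatrixDescartes` (stmt-ValiantsHypothesis-18050) or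
VP ≠ VNP; a tropical row bounds no real pencil by itself.  [cell statement R1797; folklore-level exchange, majorisation and sign arguments]
-/

set_option linter.dupNamespace false
set_option linter.unusedVariables false
set_option linter.unusedSectionVars false
set_option autoImplicit false

namespace Summit.ValiantsHypothesis.ValiantsHypothesis.Theorems.KPlusLogSqLaw

open Summit.ValiantsHypothesis.ValiantsHypothesis.Theorems.MatrixDescartes.Negative
open Summit.ValiantsHypothesis.ValiantsHypothesis.Theorems.LacunarySymmetroidMatrixDescartes
open Summit.ValiantsHypothesis.ValiantsHypothesis.Theorems.LacunarySymmetroidMatrixDescartes.TropicalCensus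
open Summit.ValiantsHypothesis.ValiantsHypothesis.Theorems.LacunarySymmetroidMatrixDescartes.TropicalCensus.Orbit
open Finset

namespace SymmetricOrbitThreeFourSixteen

open SymmetricOrbitThreeFour SymmetricThreeFour SymmetricThreeFourSeventeen SymmetricThreeFourSixteen SymmetricThreeFourFifteen

/-- with two multisets missed by an injective 18-chain, every other multiset is carried. [counting] -/
theorem get2 (r : Fin 18 → Equiv.Perm (Fin 3) × (Fin 3 → Fin 4)) (h3 : Function.Injective fun k => TropicalCensus.classSym (r k))
    (w₁ w₂ : Fin 3 → Fin 4)
    (hne : TropicalCensus.classSym ((1 : Equiv.Perm (Fin 3)), w₁) ≠ TropicalCensus.classSym ((1 : Equiv.Perm (Fin 3)), w₂))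
    (m₁ : ∀ k, TropicalCensus.classSym (r k) ≠ TropicalCensus.classSym ((1 : Equiv.Perm (Fin 3)), w₁))
    (m₂ : ∀ k, TropicalCensus.classSym (r k) ≠ TropicalCensus.classSym ((1 : Equiv.Perm (Fin 3)), w₂)) :
    ∀ w : Fin 3 → Fin 4, TropicalCensus.classSym ((1 : Equiv.Perm (Fin 3)), w) ≠ TropicalCensus.classSym ((1 : Equiv.Perm (Fin 3)), w₁) →
      TropicalCensus.classSym ((1 : Equiv.Perm (Fin 3)), w) ≠ TropicalCensus.classSym ((1 : Equiv.Perm (Fin 3)), w₂) →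
      ∃ k, TropicalCensus.classSym (r k) = TropicalCensus.classSym ((1 : Equiv.Perm (Fin 3)), w) := by
  intro w hw₁ hw₂
  by_contra hno
  push Not at hno
  have hsub : univ.image (fun k => TropicalCensus.classSym (r k)) ⊆
      ((univ.erase (TropicalCensus.classSym ((1 : Equiv.Perm (Fin 3)), w₁))).erase
        (TropicalCensus.classSym ((1 : Equiv.Perm (Fin 3)), w₂))).erase (TropicalCensus.classSym ((1 : Equiv.Perm (Fin 3)), w)) := by
    intro M hM'
    rw [mem_image] at hM'
    obtain ⟨k, -, rfl⟩ := hM'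
    rw [mem_erase, mem_erase, mem_erase]
    exact ⟨hno k, m₂ k, m₁ k, mem_univ _⟩
  have hcard := card_le_card hsub
  rw [card_image_of_injective _ h3, card_univ, Fintype.card_fin,
    card_erase_of_mem (by rw [mem_erase, mem_erase]; exact ⟨hw₂, hw₁, mem_univ _⟩),
    card_erase_of_mem (by rw [mem_erase]; exact ⟨hne.symm, mem_univ _⟩), card_erase_of_mem (mem_univ _), card_univ,
    Sym.card_sym_eq_multichoose, Fintype.card_fin] at hcard
  have h20 : Nat.multichoose 4 3 = 20 := by rw [Nat.multichoose_eq]; rfl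
  omega

section Dispatch

variable (r : Fin 18 → Equiv.Perm (Fin 3) × (Fin 3 → Fin 4)) (g : Fin 4 → ℕ) (hmono : Monotone g)
  (hshape : ∀ k, (r k).1 = 1 ∨ (∃ i j : Fin 3, i < j ∧ (r k).1 = Equiv.swap i j ∧ (r k).2 i = (r k).2 j) ∨ (∀ i, (r k).1 i ≠ i))
  (hM : ∀ a b : Fin 18, a < b → ∀ l₁ l₂ : Fin 3,
    ((r a).1 l₁ = (r b).1 l₂ ∧ l₁ = l₂) ∨ ((r a).1 l₁ = l₂ ∧ (r b).1 l₂ = l₁) → (r a).2 l₁ ≤ (r b).2 l₂)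
  (hS : ∀ a b : Fin 18, a < b → TropicalCensus.slope g (r a) < TropicalCensus.slope g (r b))
  (hR1 : ∀ a b : Fin 18, a < b → (r a).1 = 1 → ∀ i j : Fin 3, i ≠ j → (r b).1 = Equiv.swap i j → (r b).2 i = (r b).2 j →
    g ((r a).2 i) + g ((r a).2 j) < 2 * g ((r b).2 i))
  (hR1' : ∀ a b : Fin 18, a < b → (r b).1 = 1 → ∀ i j : Fin 3, i ≠ j → (r a).1 = Equiv.swap i j → (r a).2 i = (r a).2 j →
    2 * g ((r a).2 i) < g ((r b).2 i) + g ((r b).2 j))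
  (hR2 : ∀ a b : Fin 18, a < b → ∀ i j k : Fin 3, i ≠ j → k ≠ i → k ≠ j → (r a).1 = Equiv.swap i j →
    (r a).2 i = (r a).2 j → (r b).1 i = j → (r b).1 j = k → (r b).1 k = i →
    g ((r a).2 k) + g ((r a).2 i) < g ((r b).2 j) + g ((r b).2 k))
  (hR2' : ∀ a b : Fin 18, a < b → ∀ i j k : Fin 3, i ≠ j → k ≠ i → k ≠ j → (r a).1 i = j → (r a).1 j = k → (r a).1 k = i →
    (r b).1 = Equiv.swap i j → (r b).2 i = (r b).2 j → g ((r a).2 j) + g ((r a).2 k) < g ((r b).2 k) + g ((r b).2 i))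
  (hR3 : ∀ a b : Fin 18, a < b → (r a).1 = 1 → ∀ i j k : Fin 3, i ≠ j → k ≠ i → k ≠ j →
    (r b).1 i = j → (r b).1 j = k → (r b).1 k = i → g ((r a).2 i) + g ((r a).2 j) < 2 * g ((r b).2 i))
  (hR3' : ∀ a b : Fin 18, a < b → (r b).1 = 1 → ∀ i j k : Fin 3, i ≠ j → k ≠ i → k ≠ j →
    (r a).1 i = j → (r a).1 j = k → (r a).1 k = i → 2 * g ((r a).2 i) < g ((r b).2 i) + g ((r b).2 j))
  (hT3 : ∀ a b c : Fin 18, ∀ i j k : Fin 3, i ≠ j → k ≠ i → k ≠ j →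
    (r a).1 = Equiv.swap j k → (r a).2 j = (r a).2 k → (r b).1 = Equiv.swap i k → (r b).2 i = (r b).2 k →
    (r c).1 = Equiv.swap i j → (r c).2 i = (r c).2 j →
    ¬ (g ((r c).2 i) + g ((r a).2 j) + g ((r b).2 k) ≤ g ((r a).2 i) + 2 * g ((r a).2 j) ∧
        g ((r c).2 i) + g ((r a).2 j) + g ((r b).2 k) ≤ g ((r b).2 j) + 2 * g ((r b).2 k) ∧
        g ((r c).2 i) + g ((r a).2 j) + g ((r b).2 k) ≤ g ((r c).2 k) + 2 * g ((r c).2 i) ∧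
        g ((r a).2 i) + 2 * g ((r a).2 j) ≤ g ((r a).2 i) + g ((r b).2 j) + g ((r c).2 k) ∧
        g ((r b).2 j) + 2 * g ((r b).2 k) ≤ g ((r a).2 i) + g ((r b).2 j) + g ((r c).2 k) ∧
        g ((r c).2 k) + 2 * g ((r c).2 i) ≤ g ((r a).2 i) + g ((r b).2 j) + g ((r c).2 k)) ∧
    ¬ (g ((r a).2 i) + g ((r b).2 j) + g ((r c).2 k) ≤ g ((r a).2 i) + 2 * g ((r a).2 j) ∧
        g ((r a).2 i) + g ((r b).2 j) + g ((r c).2 k) ≤ g ((r b).2 j) + 2 * g ((r b).2 k) ∧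
        g ((r a).2 i) + g ((r b).2 j) + g ((r c).2 k) ≤ g ((r c).2 k) + 2 * g ((r c).2 i) ∧
        g ((r a).2 i) + 2 * g ((r a).2 j) ≤ g ((r c).2 i) + g ((r a).2 j) + g ((r b).2 k) ∧
        g ((r b).2 j) + 2 * g ((r b).2 k) ≤ g ((r c).2 i) + g ((r a).2 j) + g ((r b).2 k) ∧
        g ((r c).2 k) + 2 * g ((r c).2 i) ≤ g ((r c).2 i) + g ((r a).2 j) + g ((r b).2 k)))
  (hP1 : ∀ a b : Fin 18, ∀ k : Fin 3, (r a).1 ≠ 1 → (r a).1 k = k → (r b).1 ≠ 1 → (r b).1 k = k →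
    (r a).2 k = (r b).2 k → (a.val + b.val) % 2 = 0)
  (hP2 : ∀ e a0 a1 a2 : Fin 18, ∀ κ0 κ1 κ2 : Fin 3, κ0 ≠ κ1 → κ0 ≠ κ2 → κ1 ≠ κ2 → (r e).1 = 1 →
    ((r a0).1 ≠ 1 ∧ (r a0).1 κ0 = κ0 ∧ (r a0).2 κ0 = (r e).2 κ0) →
    ((r a1).1 ≠ 1 ∧ (r a1).1 κ1 = κ1 ∧ (r a1).2 κ1 = (r e).2 κ1) →
    ((r a2).1 ≠ 1 ∧ (r a2).1 κ2 = κ2 ∧ (r a2).2 κ2 = (r e).2 κ2) → (e.val + a0.val + a1.val + a2.val) % 2 = 1)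
  (h3 : Function.Injective fun k => TropicalCensus.classSym (r k))
include hmono hshape hM hS hR1 hR1' hR2 hR2' hR3 hR3' hT3 hP1 hP2 h3

/-- **dispatch of one missed pair** to its generated lemma: normalise orientations (`orient_elim`), choose positions `X` (`get2`). -/
theorem dispatch (A B : Fin 3 → Fin 4)
    (hAB : TropicalCensus.classSym ((1 : Equiv.Perm (Fin 3)), A) ≠ TropicalCensus.classSym ((1 : Equiv.Perm (Fin 3)), B))
    (hA : ¬ ∃ a, TropicalCensus.classSym (r a) = TropicalCensus.classSym ((1 : Equiv.Perm (Fin 3)), A))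
    (hB : ¬ ∃ b, TropicalCensus.classSym (r b) = TropicalCensus.classSym ((1 : Equiv.Perm (Fin 3)), B))
    (hmiss : ∀ (R : Fin 18 → Equiv.Perm (Fin 3) × (Fin 3 → Fin 4)),
        (∀ k, (R k).1 = 1 ∨ (∃ i j : Fin 3, i < j ∧ (R k).1 = Equiv.swap i j ∧ (R k).2 i = (R k).2 j) ∨ (∀ i, (R k).1 i ≠ i)) →
        (∀ k, (R k).1 ≠ (finRotate 3)⁻¹) →
        (∀ a b : Fin 18, a < b → ∀ l₁ l₂ : Fin 3,
      ((R a).1 l₁ = (R b).1 l₂ ∧ l₁ = l₂) ∨ ((R a).1 l₁ = l₂ ∧ (R b).1 l₂ = l₁) → (R a).2 l₁ ≤ (R b).2 l₂) →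
        (∀ a b : Fin 18, a < b → TropicalCensus.slope g (R a) < TropicalCensus.slope g (R b)) →
        (∀ a b : Fin 18, a < b → (R a).1 = 1 → ∀ i j : Fin 3, i ≠ j → (R b).1 = Equiv.swap i j → (R b).2 i = (R b).2 j →
      g ((R a).2 i) + g ((R a).2 j) < 2 * g ((R b).2 i)) →
        (∀ a b : Fin 18, a < b → (R b).1 = 1 → ∀ i j : Fin 3, i ≠ j → (R a).1 = Equiv.swap i j → (R a).2 i = (R a).2 j →
      2 * g ((R a).2 i) < g ((R b).2 i) + g ((R b).2 j)) →
        (∀ a b : Fin 18, a < b → ∀ i j k : Fin 3, i ≠ j → k ≠ i → k ≠ j → (R a).1 = Equiv.swap i j →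
      (R a).2 i = (R a).2 j → (R b).1 i = j → (R b).1 j = k → (R b).1 k = i →
      g ((R a).2 k) + g ((R a).2 i) < g ((R b).2 j) + g ((R b).2 k)) →
        (∀ a b : Fin 18, a < b → ∀ i j k : Fin 3, i ≠ j → k ≠ i → k ≠ j → (R a).1 i = j → (R a).1 j = k → (R a).1 k = i →
      (R b).1 = Equiv.swap i j → (R b).2 i = (R b).2 j → g ((R a).2 j) + g ((R a).2 k) < g ((R b).2 k) + g ((R b).2 i)) →
        (∀ a b : Fin 18, a < b → (R a).1 = 1 → ∀ i j k : Fin 3, i ≠ j → k ≠ i → k ≠ j →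
      (R b).1 i = j → (R b).1 j = k → (R b).1 k = i → g ((R a).2 i) + g ((R a).2 j) < 2 * g ((R b).2 i)) →
        (∀ a b : Fin 18, a < b → (R b).1 = 1 → ∀ i j k : Fin 3, i ≠ j → k ≠ i → k ≠ j →
      (R a).1 i = j → (R a).1 j = k → (R a).1 k = i → 2 * g ((R a).2 i) < g ((R b).2 i) + g ((R b).2 j)) →
        (∀ a b c : Fin 18, ∀ i j k : Fin 3, i ≠ j → k ≠ i → k ≠ j →
      (R a).1 = Equiv.swap j k → (R a).2 j = (R a).2 k → (R b).1 = Equiv.swap i k → (R b).2 i = (R b).2 k →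
      (R c).1 = Equiv.swap i j → (R c).2 i = (R c).2 j →
      ¬ (g ((R c).2 i) + g ((R a).2 j) + g ((R b).2 k) ≤ g ((R a).2 i) + 2 * g ((R a).2 j) ∧
          g ((R c).2 i) + g ((R a).2 j) + g ((R b).2 k) ≤ g ((R b).2 j) + 2 * g ((R b).2 k) ∧
          g ((R c).2 i) + g ((R a).2 j) + g ((R b).2 k) ≤ g ((R c).2 k) + 2 * g ((R c).2 i) ∧
          g ((R a).2 i) + 2 * g ((R a).2 j) ≤ g ((R a).2 i) + g ((R b).2 j) + g ((R c).2 k) ∧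
          g ((R b).2 j) + 2 * g ((R b).2 k) ≤ g ((R a).2 i) + g ((R b).2 j) + g ((R c).2 k) ∧
          g ((R c).2 k) + 2 * g ((R c).2 i) ≤ g ((R a).2 i) + g ((R b).2 j) + g ((R c).2 k)) ∧
      ¬ (g ((R a).2 i) + g ((R b).2 j) + g ((R c).2 k) ≤ g ((R a).2 i) + 2 * g ((R a).2 j) ∧
          g ((R a).2 i) + g ((R b).2 j) + g ((R c).2 k) ≤ g ((R b).2 j) + 2 * g ((R b).2 k) ∧
          g ((R a).2 i) + g ((R b).2 j) + g ((R c).2 k) ≤ g ((R c).2 k) + 2 * g ((R c).2 i) ∧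
          g ((R a).2 i) + 2 * g ((R a).2 j) ≤ g ((R c).2 i) + g ((R a).2 j) + g ((R b).2 k) ∧
          g ((R b).2 j) + 2 * g ((R b).2 k) ≤ g ((R c).2 i) + g ((R a).2 j) + g ((R b).2 k) ∧
          g ((R c).2 k) + 2 * g ((R c).2 i) ≤ g ((R c).2 i) + g ((R a).2 j) + g ((R b).2 k))) →
        (∀ a b : Fin 18, ∀ k : Fin 3, (R a).1 ≠ 1 → (R a).1 k = k → (R b).1 ≠ 1 → (R b).1 k = k →
      (R a).2 k = (R b).2 k → (a.val + b.val) % 2 = 0) →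
        (∀ e a0 a1 a2 : Fin 18, ∀ κ0 κ1 κ2 : Fin 3, κ0 ≠ κ1 → κ0 ≠ κ2 → κ1 ≠ κ2 → (R e).1 = 1 →
      ((R a0).1 ≠ 1 ∧ (R a0).1 κ0 = κ0 ∧ (R a0).2 κ0 = (R e).2 κ0) →
      ((R a1).1 ≠ 1 ∧ (R a1).1 κ1 = κ1 ∧ (R a1).2 κ1 = (R e).2 κ1) →
      ((R a2).1 ≠ 1 ∧ (R a2).1 κ2 = κ2 ∧ (R a2).2 κ2 = (R e).2 κ2) → (e.val + a0.val + a1.val + a2.val) % 2 = 1) →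
        ∀ (X : (Fin 3 → Fin 4) → Fin 18), (∀ w : Fin 3 → Fin 4, TropicalCensus.classSym ((1 : Equiv.Perm (Fin 3)), w) ≠ TropicalCensus.classSym ((1 : Equiv.Perm (Fin 3)), A) →
          TropicalCensus.classSym ((1 : Equiv.Perm (Fin 3)), w) ≠ TropicalCensus.classSym ((1 : Equiv.Perm (Fin 3)), B) → TropicalCensus.classSym (R (X w)) = TropicalCensus.classSym ((1 : Equiv.Perm (Fin 3)), w)) → False) : False := by
  have m₁ : ∀ k, TropicalCensus.classSym (r k) ≠ TropicalCensus.classSym ((1 : Equiv.Perm (Fin 3)), A) := fun k hk => hA ⟨k, hk⟩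
  have m₂ : ∀ k, TropicalCensus.classSym (r k) ≠ TropicalCensus.classSym ((1 : Equiv.Perm (Fin 3)), B) := fun k hk => hB ⟨k, hk⟩
  have hget := get2 r h3 A B hAB m₁ m₂
  have hX' : ∀ w : Fin 3 → Fin 4, ∃ k : Fin 18,
      TropicalCensus.classSym ((1 : Equiv.Perm (Fin 3)), w) ≠ TropicalCensus.classSym ((1 : Equiv.Perm (Fin 3)), A) →
      TropicalCensus.classSym ((1 : Equiv.Perm (Fin 3)), w) ≠ TropicalCensus.classSym ((1 : Equiv.Perm (Fin 3)), B) →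
      TropicalCensus.classSym (r k) = TropicalCensus.classSym ((1 : Equiv.Perm (Fin 3)), w) := by
    intro w
    by_cases h : TropicalCensus.classSym ((1 : Equiv.Perm (Fin 3)), w) ≠ TropicalCensus.classSym ((1 : Equiv.Perm (Fin 3)), A) ∧
        TropicalCensus.classSym ((1 : Equiv.Perm (Fin 3)), w) ≠ TropicalCensus.classSym ((1 : Equiv.Perm (Fin 3)), B)
    · obtain ⟨k, hk⟩ := hget w h.1 h.2
      exact ⟨k, fun _ _ => hk⟩
    · exact ⟨0, fun h1 h2 => (h ⟨h1, h2⟩).elim⟩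
  choose X hX using hX'
  refine orient_elim r g hshape hM hS hR1 hR1' hR2 hR2' hR3 hR3' hT3 hP1 hP2
    fun R hcs hshapeR hnormR hMR hSR hR1R hR1pR hR2R hR2pR hR3R hR3pR hT3R hP1R hP2R => ?_
  exact hmiss R hshapeR hnormR hMR hSR hR1R hR1pR hR2R hR2pR hR3R hR3pR hT3R hP1R hP2R X fun w h1 h2 => (hcs (X w)).trans (hX w h1 h2)

end Dispatch

/-- **CORE (face-free), orbit model, SIXTEEN.**  Under the abstract orbit-chain hypotheses — pairwise rules, the T-triple rule and the parity
rules P1/P2 — with pairwise distinct rank multisets, `n ≤ 16`: eighteen of the twenty multisets cannot be carried.  The two missed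
multisets `{M₁, M₂}` either avoid one of the five cores of `core17` (then that core is carried in full) or form one of twelve pairs, each
excluded by its generated lemma `miss_M₁_M₂`. [counting + cores + generated case analysis] -/
theorem core16 (n : ℕ) (r : Fin (n + 1) → Equiv.Perm (Fin 3) × (Fin 3 → Fin 4)) (g : Fin 4 → ℕ) (hmono : Monotone g)
    (hshape : ∀ k, (r k).1 = 1 ∨ (∃ i j : Fin 3, i < j ∧ (r k).1 = Equiv.swap i j ∧ (r k).2 i = (r k).2 j) ∨ (∀ i, (r k).1 i ≠ i))
    (hM : ∀ a b : Fin (n + 1), a < b → ∀ l₁ l₂ : Fin 3,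
      ((r a).1 l₁ = (r b).1 l₂ ∧ l₁ = l₂) ∨ ((r a).1 l₁ = l₂ ∧ (r b).1 l₂ = l₁) → (r a).2 l₁ ≤ (r b).2 l₂)
    (hS : ∀ a b : Fin (n + 1), a < b → TropicalCensus.slope g (r a) < TropicalCensus.slope g (r b))
    (hR1 : ∀ a b : Fin (n + 1), a < b → (r a).1 = 1 → ∀ i j : Fin 3, i ≠ j → (r b).1 = Equiv.swap i j → (r b).2 i = (r b).2 j →
      g ((r a).2 i) + g ((r a).2 j) < 2 * g ((r b).2 i))
    (hR1' : ∀ a b : Fin (n + 1), a < b → (r b).1 = 1 → ∀ i j : Fin 3, i ≠ j → (r a).1 = Equiv.swap i j → (r a).2 i = (r a).2 j →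
      2 * g ((r a).2 i) < g ((r b).2 i) + g ((r b).2 j))
    (hR2 : ∀ a b : Fin (n + 1), a < b → ∀ i j k : Fin 3, i ≠ j → k ≠ i → k ≠ j → (r a).1 = Equiv.swap i j →
      (r a).2 i = (r a).2 j → (r b).1 i = j → (r b).1 j = k → (r b).1 k = i →
      g ((r a).2 k) + g ((r a).2 i) < g ((r b).2 j) + g ((r b).2 k))
    (hR2' : ∀ a b : Fin (n + 1), a < b → ∀ i j k : Fin 3, i ≠ j → k ≠ i → k ≠ j → (r a).1 i = j → (r a).1 j = k → (r a).1 k = i →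
      (r b).1 = Equiv.swap i j → (r b).2 i = (r b).2 j → g ((r a).2 j) + g ((r a).2 k) < g ((r b).2 k) + g ((r b).2 i))
    (hR3 : ∀ a b : Fin (n + 1), a < b → (r a).1 = 1 → ∀ i j k : Fin 3, i ≠ j → k ≠ i → k ≠ j →
      (r b).1 i = j → (r b).1 j = k → (r b).1 k = i → g ((r a).2 i) + g ((r a).2 j) < 2 * g ((r b).2 i))
    (hR3' : ∀ a b : Fin (n + 1), a < b → (r b).1 = 1 → ∀ i j k : Fin 3, i ≠ j → k ≠ i → k ≠ j →
      (r a).1 i = j → (r a).1 j = k → (r a).1 k = i → 2 * g ((r a).2 i) < g ((r b).2 i) + g ((r b).2 j))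
    (hT3 : ∀ a b c : Fin (n + 1), ∀ i j k : Fin 3, i ≠ j → k ≠ i → k ≠ j →
      (r a).1 = Equiv.swap j k → (r a).2 j = (r a).2 k → (r b).1 = Equiv.swap i k → (r b).2 i = (r b).2 k →
      (r c).1 = Equiv.swap i j → (r c).2 i = (r c).2 j →
      ¬ (g ((r c).2 i) + g ((r a).2 j) + g ((r b).2 k) ≤ g ((r a).2 i) + 2 * g ((r a).2 j) ∧
          g ((r c).2 i) + g ((r a).2 j) + g ((r b).2 k) ≤ g ((r b).2 j) + 2 * g ((r b).2 k) ∧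
          g ((r c).2 i) + g ((r a).2 j) + g ((r b).2 k) ≤ g ((r c).2 k) + 2 * g ((r c).2 i) ∧
          g ((r a).2 i) + 2 * g ((r a).2 j) ≤ g ((r a).2 i) + g ((r b).2 j) + g ((r c).2 k) ∧
          g ((r b).2 j) + 2 * g ((r b).2 k) ≤ g ((r a).2 i) + g ((r b).2 j) + g ((r c).2 k) ∧
          g ((r c).2 k) + 2 * g ((r c).2 i) ≤ g ((r a).2 i) + g ((r b).2 j) + g ((r c).2 k)) ∧
      ¬ (g ((r a).2 i) + g ((r b).2 j) + g ((r c).2 k) ≤ g ((r a).2 i) + 2 * g ((r a).2 j) ∧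
          g ((r a).2 i) + g ((r b).2 j) + g ((r c).2 k) ≤ g ((r b).2 j) + 2 * g ((r b).2 k) ∧
          g ((r a).2 i) + g ((r b).2 j) + g ((r c).2 k) ≤ g ((r c).2 k) + 2 * g ((r c).2 i) ∧
          g ((r a).2 i) + 2 * g ((r a).2 j) ≤ g ((r c).2 i) + g ((r a).2 j) + g ((r b).2 k) ∧
          g ((r b).2 j) + 2 * g ((r b).2 k) ≤ g ((r c).2 i) + g ((r a).2 j) + g ((r b).2 k) ∧
          g ((r c).2 k) + 2 * g ((r c).2 i) ≤ g ((r c).2 i) + g ((r a).2 j) + g ((r b).2 k)))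
    (hP1 : ∀ a b : Fin (n + 1), ∀ k : Fin 3, (r a).1 ≠ 1 → (r a).1 k = k → (r b).1 ≠ 1 → (r b).1 k = k →
      (r a).2 k = (r b).2 k → (a.val + b.val) % 2 = 0)
    (hP2 : ∀ e a0 a1 a2 : Fin (n + 1), ∀ κ0 κ1 κ2 : Fin 3, κ0 ≠ κ1 → κ0 ≠ κ2 → κ1 ≠ κ2 → (r e).1 = 1 →
      ((r a0).1 ≠ 1 ∧ (r a0).1 κ0 = κ0 ∧ (r a0).2 κ0 = (r e).2 κ0) →
      ((r a1).1 ≠ 1 ∧ (r a1).1 κ1 = κ1 ∧ (r a1).2 κ1 = (r e).2 κ1) →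
      ((r a2).1 ≠ 1 ∧ (r a2).1 κ2 = κ2 ∧ (r a2).2 κ2 = (r e).2 κ2) → (e.val + a0.val + a1.val + a2.val) % 2 = 1)
    (h3 : Function.Injective fun k => TropicalCensus.classSym (r k))
    : n ≤ 16 := by
  have h17 : n ≤ 17 := core17 n r g hmono hshape hM h3 hR1 hR1' hR2 hR2' hR3 hR3'
  by_contra hn
  have hn17 : n = 17 := by omega
  subst hn17
  by_cases h013 : ∃ a, TropicalCensus.classSym (r a) = TropicalCensus.classSym ((1 : Equiv.Perm (Fin 3)), (![0, 1, 3] : Fin 3 → Fin 4))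
  · obtain ⟨a, ha⟩ := h013
    by_cases h023 : ∃ b, TropicalCensus.classSym (r b) = TropicalCensus.classSym ((1 : Equiv.Perm (Fin 3)), (![0, 2, 3] : Fin 3 → Fin 4))
    · obtain ⟨b, hb⟩ := h023
      by_cases h112 : ∃ c, TropicalCensus.classSym (r c) = TropicalCensus.classSym ((1 : Equiv.Perm (Fin 3)), (![1, 1, 2] : Fin 3 → Fin 4))
      · obtain ⟨c, hc⟩ := h112
        by_cases h122 : ∃ e, TropicalCensus.classSym (r e) = TropicalCensus.classSym ((1 : Equiv.Perm (Fin 3)), (![1, 2, 2] : Fin 3 → Fin 4))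
        · obtain ⟨e, he⟩ := h122
          exact orbY r g hmono hshape hM hR1 hR1' hR2 hR2' hR3 hR3' a b c e ha hb hc he
        · -- `{1,2,2}` missed
          by_cases h022 : ∃ f, TropicalCensus.classSym (r f) = TropicalCensus.classSym ((1 : Equiv.Perm (Fin 3)), (![0, 2, 2] : Fin 3 → Fin 4))
          · by_cases h111 : ∃ q, TropicalCensus.classSym (r q) = TropicalCensus.classSym ((1 : Equiv.Perm (Fin 3)), (![1, 1, 1] : Fin 3 → Fin 4))
            · obtain ⟨f, hf⟩ := h022
              obtain ⟨q, hq⟩ := h111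
              refine mirror_elim r g hmono hshape hM hR1 hR1' hR2 hR2' hR3 hR3' fun R G hR hmonoG hshR hMR h1R h1R' h2R h2R' h3R h3R' => ?_
              have ka := hit_mirror r ![0, 1, 3] ![0, 2, 3] (by decide) hb
              have kb := hit_mirror r ![0, 2, 3] ![0, 1, 3] (by decide) ha
              have kf := hit_mirror r ![1, 1, 3] ![0, 2, 2] (by decide) hf
              have ke := hit_mirror r ![1, 2, 2] ![1, 1, 2] (by decide) hc
              have kq := hit_mirror r ![2, 2, 2] ![1, 1, 1] (by decide) hq
              rw [← hR] at ka kb kf ke kq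
              exact core5 R G hmonoG hshR hMR h1R h1R' h2R h2R' h3R h3R' b.rev a.rev f.rev c.rev q.rev ka kb kf ke kq
            · exact dispatch r g hmono hshape hM hS hR1 hR1' hR2 hR2' hR3 hR3' hT3 hP1 hP2 h3 ![1, 2, 2] ![1, 1, 1] (by decide) h122 h111 (fun R => miss_122_111 R g hmono)
          · exact dispatch r g hmono hshape hM hS hR1 hR1' hR2 hR2' hR3 hR3' hT3 hP1 hP2 h3 ![1, 2, 2] ![0, 2, 2] (by decide) h122 h022 (fun R => miss_122_022 R g hmono)
      · -- `{1,1,2}` missed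
        by_cases h122 : ∃ e, TropicalCensus.classSym (r e) = TropicalCensus.classSym ((1 : Equiv.Perm (Fin 3)), (![1, 2, 2] : Fin 3 → Fin 4))
        · by_cases h113 : ∃ f, TropicalCensus.classSym (r f) = TropicalCensus.classSym ((1 : Equiv.Perm (Fin 3)), (![1, 1, 3] : Fin 3 → Fin 4))
          · by_cases h222 : ∃ q, TropicalCensus.classSym (r q) = TropicalCensus.classSym ((1 : Equiv.Perm (Fin 3)), (![2, 2, 2] : Fin 3 → Fin 4))
            · obtain ⟨e, he⟩ := h122
              obtain ⟨f, hf⟩ := h113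
              obtain ⟨q, hq⟩ := h222
              exact core5 r g hmono hshape hM hR1 hR1' hR2 hR2' hR3 hR3' a b f e q ha hb hf he hq
            · exact dispatch r g hmono hshape hM hS hR1 hR1' hR2 hR2' hR3 hR3' hT3 hP1 hP2 h3 ![1, 1, 2] ![2, 2, 2] (by decide) h112 h222 (fun R => miss_112_222 R g hmono)
          · exact dispatch r g hmono hshape hM hS hR1 hR1' hR2 hR2' hR3 hR3' hT3 hP1 hP2 h3 ![1, 1, 2] ![1, 1, 3] (by decide) h112 h113 (fun R => miss_112_113 R g hmono)
        · exact dispatch r g hmono hshape hM hS hR1 hR1' hR2 hR2' hR3 hR3' hT3 hP1 hP2 h3 ![1, 1, 2] ![1, 2, 2] (by decide) h112 h122 (fun R => miss_112_122 R g hmono)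
    · -- `{0,2,3}` missed
      by_cases h033 : ∃ z, TropicalCensus.classSym (r z) = TropicalCensus.classSym ((1 : Equiv.Perm (Fin 3)), (![0, 3, 3] : Fin 3 → Fin 4))
      · by_cases h112 : ∃ c, TropicalCensus.classSym (r c) = TropicalCensus.classSym ((1 : Equiv.Perm (Fin 3)), (![1, 1, 2] : Fin 3 → Fin 4))
        · by_cases h122 : ∃ e, TropicalCensus.classSym (r e) = TropicalCensus.classSym ((1 : Equiv.Perm (Fin 3)), (![1, 2, 2] : Fin 3 → Fin 4))
          · obtain ⟨z, hz⟩ := h033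
            obtain ⟨c, hc⟩ := h112
            obtain ⟨e, he⟩ := h122
            refine mirror_elim r g hmono hshape hM hR1 hR1' hR2 hR2' hR3 hR3' fun R G hR hmonoG hshR hMR h1R h1R' h2R h2R' h3R h3R' => ?_
            have kz := hit_mirror r ![0, 0, 3] ![0, 3, 3] (by decide) hz
            have kb := hit_mirror r ![0, 2, 3] ![0, 1, 3] (by decide) ha
            have kc := hit_mirror r ![1, 1, 2] ![1, 2, 2] (by decide) he
            have ke := hit_mirror r ![1, 2, 2] ![1, 1, 2] (by decide) hc
            rw [← hR] at kz kb kc ke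
            exact orbV2 R G hmonoG hshR hMR h1R h1R' h2R h2R' h3R h3R' z.rev a.rev e.rev c.rev kz kb kc ke
          · exact dispatch r g hmono hshape hM hS hR1 hR1' hR2 hR2' hR3 hR3' hT3 hP1 hP2 h3 ![1, 2, 2] ![0, 2, 3] (by decide) h122 h023 (fun R => miss_122_023 R g hmono)
        · exact dispatch r g hmono hshape hM hS hR1 hR1' hR2 hR2' hR3 hR3' hT3 hP1 hP2 h3 ![1, 1, 2] ![0, 2, 3] (by decide) h112 h023 (fun R => miss_112_023 R g hmono)
      · exact dispatch r g hmono hshape hM hS hR1 hR1' hR2 hR2' hR3 hR3' hT3 hP1 hP2 h3 ![0, 2, 3] ![0, 3, 3] (by decide) h023 h033 (fun R => miss_023_033 R g hmono)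
  · -- `{0,1,3}` missed
    by_cases h023 : ∃ b, TropicalCensus.classSym (r b) = TropicalCensus.classSym ((1 : Equiv.Perm (Fin 3)), (![0, 2, 3] : Fin 3 → Fin 4))
    · by_cases h003 : ∃ z, TropicalCensus.classSym (r z) = TropicalCensus.classSym ((1 : Equiv.Perm (Fin 3)), (![0, 0, 3] : Fin 3 → Fin 4))
      · by_cases h122 : ∃ e, TropicalCensus.classSym (r e) = TropicalCensus.classSym ((1 : Equiv.Perm (Fin 3)), (![1, 2, 2] : Fin 3 → Fin 4))
        · by_cases h112 : ∃ c, TropicalCensus.classSym (r c) = TropicalCensus.classSym ((1 : Equiv.Perm (Fin 3)), (![1, 1, 2] : Fin 3 → Fin 4))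
          · obtain ⟨z, hz⟩ := h003
            obtain ⟨b, hb⟩ := h023
            obtain ⟨c, hc⟩ := h112
            obtain ⟨e, he⟩ := h122
            exact orbV2 r g hmono hshape hM hR1 hR1' hR2 hR2' hR3 hR3' z b c e hz hb hc he
          · exact dispatch r g hmono hshape hM hS hR1 hR1' hR2 hR2' hR3 hR3' hT3 hP1 hP2 h3 ![1, 1, 2] ![0, 1, 3] (by decide) h112 h013 (fun R => miss_112_013 R g hmono)
        · exact dispatch r g hmono hshape hM hS hR1 hR1' hR2 hR2' hR3 hR3' hT3 hP1 hP2 h3 ![1, 2, 2] ![0, 1, 3] (by decide) h122 h013 (fun R => miss_122_013 R g hmono)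
      · exact dispatch r g hmono hshape hM hS hR1 hR1' hR2 hR2' hR3 hR3' hT3 hP1 hP2 h3 ![0, 1, 3] ![0, 0, 3] (by decide) h013 h003 (fun R => miss_013_003 R g hmono)
    · exact dispatch r g hmono hshape hM hS hR1 hR1' hR2 hR2' hR3 hR3' hT3 hP1 hP2 h3 ![0, 1, 3] ![0, 2, 3] (by decide) h013 h023 (fun R => miss_013_023 R g hmono)

end SymmetricOrbitThreeFourSixteen

open SymmetricOrbitThreeFourSixteen SymmetricOrbitThreeFour

/-- **`T^orb_sym(3,4) ≤ 16` ON EVERY SUPPORT — the cell value in the kernel.**  A SYMMETRIC `3 × 3` dominance design with four slope classes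
has at most `16` sign-alternating ORBIT-dominant breakpoints along increasing integer slopes (orbit model: a term beats every present term
outside its transpose orbit).  Face-free; NOT sign-free (the parity rules use the alternation).  Sharp: `16` alternations are attained
(p504693).  Ingredients beyond `core17`: the T-triple rule (p509441) and the parity rules (p510197); the residual finite case analysis is
generated (`miss_*`). [cell statement R1797/R1798; folklore-level arguments + generated bookkeeping] -/
theorem tropRow_three_four_symmOrb_le_sixteen (d : Fin 4 → ℕ) (v ε : Fin 3 → Fin 3 → Fin 4 → ℤ)
    (hv : ∀ i j l, v i j l = v j i l) (hεs : ∀ i j l, ε i j l = ε j i l)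
    (n : ℕ) (θ : Fin (n + 1) → ℤ) (p : Fin (n + 1) → Equiv.Perm (Fin 3) × (Fin 3 → Fin 4))
    (hθ : StrictMono θ) (hdom : ∀ k, IsOrbitDominant d v ε (θ k) (p k))
    (halt : ∀ k : Fin n, termSign ε (p k.castSucc) * termSign ε (p k.succ) < 0) : n ≤ 16 := by
  -- sign data for the parity rules
  have hs0 : ∀ a, termSign ε (p a) ≠ 0 := fun a => (hdom a).1
  have hslope : ∀ k, TropicalCensus.slope d (p k) =
      TropicalCensus.slope (d ∘ Tuple.sort d) ((p k).1, fun i => (Tuple.sort d).symm ((p k).2 i)) := by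
    intro k
    unfold TropicalCensus.slope
    simp
  refine core16 n (fun k => ((p k).1, fun i => (Tuple.sort d).symm ((p k).2 i))) (d ∘ Tuple.sort d)
    (Tuple.monotone_sort d)
    (fun k => orbitChain_shape d v ε hv hεs θ p hdom k)
    (fun a b hab l₁ l₂ hcell => orbitChain_M d v ε hv hεs θ p hθ hdom a b hab l₁ l₂ hcell)
    (fun a b hab => ?_)
    (fun a b hab ha1 _ _ hij hb1 hcc => orbitChain_R1 d v ε θ p hθ hdom a b hab ha1 hij hb1 hcc)
    (fun a b hab hb1 _ _ hij ha1 hcc => orbitChain_R1' d v ε θ p hθ hdom a b hab hb1 hij ha1 hcc)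
    (fun a b hab _ _ _ hij hki hkj ha1 hcc hbi hbj hbk => orbitChain_R2 d v ε hv hεs θ p hθ hdom a b hab hij hki hkj ha1 hcc hbi hbj hbk)
    (fun a b hab _ _ _ hij hki hkj hai haj hak hb1 hcc => orbitChain_R2' d v ε hv hεs θ p hθ hdom a b hab hij hki hkj hai haj hak hb1 hcc)
    (fun a b hab ha1 _ _ _ hij hki hkj hbi hbj hbk => orbitChain_R3 d v ε hv hεs θ p hθ hdom a b hab ha1 hij hki hkj hbi hbj hbk)
    (fun a b hab hb1 _ _ _ hij hki hkj hai haj hak => orbitChain_R3' d v ε hv hεs θ p hθ hdom a b hab hb1 hij hki hkj hai haj hak)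
    (fun a b c i j k hij hki hkj ha1 hca hb1 hcb hc1 hcc => orbitChain_T3 d v ε hv θ p hdom a b c hij hki hkj ha1 hca hb1 hcb hc1 hcc)
    (fun a b k ha1 hak hb1 hbk hx => ?_) (fun e a0 a1 a2 κ0 κ1 κ2 h01 h02 h12 he1 h0 h1 h2 => ?_)
    (orbitChain_injective d v ε hv hεs θ p hθ hdom halt)
  · -- rule S in rank form
    have h := orbitChain_S d v ε hv hεs θ p hθ hdom halt a b hab
    rw [hslope, hslope] at h
    exact h
  · -- P1
    have h := signChain_P1 (fun k => ((p k).1, fun i => (Tuple.sort d).symm ((p k).2 i))) (fun k => termSign ε (p k))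
      (fun l x => ε l l ((Tuple.sort d) x)) hs0
      (fun a k hne hk t => orbitChain_signT d v ε hv hεs θ p hdom a k hne hk t) halt a b k ha1 hak hb1 hbk hx
    exact Nat.even_iff.mp h
  · -- P2
    have h := signChain_P2 (fun k => ((p k).1, fun i => (Tuple.sort d).symm ((p k).2 i))) (fun k => termSign ε (p k))
      (fun l x => ε l l ((Tuple.sort d) x)) hs0 (fun a ha1 => orbitChain_signD d ε p a ha1)
      (fun a k hne hk t => orbitChain_signT d v ε hv hεs θ p hdom a k hne hk t) halt e a0 a1 a2 κ0 κ1 κ2 h01 h02 h12 he1 h0 h1 h2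
    exact Nat.odd_iff.mp h

/-- **`TropRootLawAtSymmOrb 3 4 16`** — the ORBIT row of the cell at its value; with p504693 (`¬ TropRootLawAtSymmOrb 3 4 15`) the
kernel window of the orbit row is closed: exactly `16`. [restatement] -/
theorem tropRootLawAtSymmOrb_three_four_sixteen : TropRootLawAtSymmOrb 3 4 16 :=
  fun d v ε hv hε n θ p hθ hdom halt => tropRow_three_four_symmOrb_le_sixteen d v ε hv hε n θ p hθ hdom halt

/-- **`TSymOrb34Le16` holds** («T^orb_sym(3,4) ≤ 16 on every support», the port target of record of `KPlusLogSqLawTropicalOrbitDominance`). -/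
theorem tSymOrb34Le16_holds : TSymOrb34Le16 :=
  tropRootLawAtSymmOrb_three_four_sixteen

/-- the orbit row of the cell in the kernel: `TropRootLawAtSymmOrb 3 4 B ↔ 16 ≤ B`. [p504693 + this file] -/
theorem tropRootLawAtSymmOrb_three_four_iff (B : ℕ) : TropRootLawAtSymmOrb 3 4 B ↔ 16 ≤ B :=
  ⟨sixteen_le_of_tropRootLawAtSymmOrb, fun hB d v ε hv hε n θ p hθ hdom halt =>
    (tropRow_three_four_symmOrb_le_sixteen d v ε hv hε n θ p hθ hdom halt).trans hB⟩

end Summit.ValiantsHypothesis.ValiantsHypothesis.Theorems.KPlusLogSqLaw
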